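import Mathlib.MeasureTheory.Measure.Tilted
import Mathlib.MeasureTheory.Constructions.Pi
import Mathlib.MeasureTheory.Constructions.BorelSpace.Basic
import Mathlib.Analysis.InnerProductSpace.PiL2
import Mathlib.Combinatorics.SimpleGraph.Finite
import Mathlib.Combinatorics.SimpleGraph.Maps
import Literature.MathematicalPhysics.QuantumLattice.RandomField
import Literature.Probability.LatticeModels.LatticeGraph
import Literature.Probability.LatticeModels.ThermodynamicLimit
import Literature.Probability.LatticeModels.Correlations
import Literature.Probability.LatticeModels.GibbsSpecification
import HarnessLib

-- provenance: harness21/H21/H21/Prelude/QLatticeAQFT/LatticeScalarField.lean @ 7095ce4 (interim HEAD d8f2665); M5 mechanical rewrite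
/-!
# Lattice scalar (`φ⁴` / Ising-type) fields and their smeared continuum fields

Trunk **T-AQFT** (G13, Part A, item A7), families `constructive-qft` (S22–S24), `crit-ising`
(S02). Notion: `phi4_lattice_field`.

This file provides

* the lattice `φ⁴` action `phi4Action G g κ J φ = ∑ₓ (g φₓ⁴ + κ φₓ²) − J ∑_{xy ∈ E(G)} φₓ φ_y`
  on a finite simple graph and its Gibbs measure `phi4Measure G g κ J`, the exponential tilt of
  Lebesgue measure on `V → ℝ` by `−phi4Action`; more generally `latticeFieldMeasure ν G J`
  (product of a single-site law `ν`, tilted by the nearest-neighbour coupling) and the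
  single-site hypothesis class `IsGriffithsSimonClass ν`;
* the `ℤᵈ` versions (free boundary condition in a finite volume, glued with `0` outside; and
  the periodic version on the discrete torus): `phi4FreeMeasure`, `phi4BoxMeasure`,
  `phi4TorusMeasure`, two-point functions, the susceptibility `phi4Susceptibility` and the
  critical coupling `phi4CriticalJ`, `IsCriticalFamily`;
* the *smearing* of a lattice field against Schwartz test functions at lattice spacing `δ` with
  field-strength renormalisation `ρ`:
  `finLatticeField Λ δ ρ φ = ∑_{x ∈ Λ} (ρ δᵈ φₓ) • δ_{δx} ∈ FieldConfig ℝᵈ`, i.e.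
  `Φ_δ(f) = ρ δᵈ ∑_{x ∈ Λ} f(δx) φₓ`, and the induced laws `latticeFieldLaw`, `torusFieldLaw`,
  `spinFieldLaw` on `FieldConfig (EuclideanSpace ℝ (Fin d))`.

## Sources

* J. Glimm, A. Jaffe, *Quantum Physics: a functional integral point of view* (2nd ed. 1987),
  §9.5–9.6 (lattice approximation of `P(φ)₂`, lattice action and its continuum dictionary).
* R. Griffiths, B. Simon, *The `(φ⁴)₂` field theory as a classical Ising model*, Comm. Math.
  Phys. 33 (1973) 145–164.
* M. Aizenman, H. Duminil-Copin, *Marginal triviality of the scaling limits of critical 4D Ising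
  and `φ⁴₄` models*, Ann. Math. 194 (2021), §1.2 (lattice `φ⁴` measures, smeared fields
  `T_{f,L}`, Griffiths–Simon class), Thm 1.2–1.3.
* S. Friedli, Y. Velenik, *Statistical Mechanics of Lattice Systems* (2017), §3.2, §3.7
  (thermodynamic limit along boxes, susceptibility, critical point).

## Mathlib

Used: `MeasureTheory.Measure.pi`, `volume` on `ℝ`, `MeasureTheory.Measure.tilted` (exponential
tilt, automatically normalised; it is the zero measure when the density is not integrable),
`SimpleGraph.edgeFinset`, `Sym2.lift`, `SimpleGraph.comap` (induced graph on a finite volume),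
`EuclideanSpace`, `WithLp.toLp`, `Measure.map`. From H21: `AQFT.FieldConfig`, `AQFT.deltaConfig`,
`AQFT.measurable_finset_sum_smul_deltaConfig`, `StatMech.zdGraph`, `StatMech.torusGraph`,
`StatMech.Torus.proj`, `StatMech.box`, `StatMech.boxLim`, `StatMech.twoPoint`,
`StatMech.spinAt`, `StatMech.glueWith` (G02 gluing = `Function.updateFinset`).
`Measure.IsNegInvariant` (evenness of the single-site law). Verified absent at the pin: lattice `φ⁴`/`P(φ)` measures,
smeared lattice fields.

## Design

* **Parameter names.** The lattice couplings are `(g κ J)` (`g` quartic, `κ` quadratic, `J`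
  nearest-neighbour), *not* `λ`, to avoid the clash with the continuum coupling `λ` of
  `constructive-qft.S22/S23`. The docstring of `phi4Action` records the standard lattice
  regularisation dictionary consumed verbatim by S22/S23.
* `phi4Measure` is `Measure.tilted`, hence a probability measure exactly when
  `exp (−phi4Action)` is Lebesgue integrable (`0 < g`, or `g = 0` and `κ` large); this is the
  theorem `isProbabilityMeasure_phi4Measure` (not an instance, since it needs `0 < g`).
* Finite volumes `Λ ⊆ ℤᵈ` with free boundary condition use the induced graph
  `(zdGraph d).comap Subtype.val` on `↥Λ` and glue with `0` outside `Λ` (`glueZero`), so that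
  all finite-volume measures live on the common space `Site d → ℝ` and `StatMech.boxLim`
  applies (`glueZero` is an `abbrev` for G02's `StatMech.glueWith Λ · 0`, i.e. Mathlib's
  `Function.updateFinset`). The periodic version `phi4TorusMeasure d L` stays on
  `TorusSite d L → ℝ`.
* **Centred torus smearing.** `finLatticeFieldTorus L δ ρ` takes a periodic configuration on
  the torus of *odd side* `2L+1` and smears its lift along `Torus.proj (2L+1)` over the
  *centred* fundamental domain `box d L = {−L,…,L}ᵈ`, so that the smeared cubes
  `[−(L+½)δ, (L+½)δ]ᵈ` exhaust `ℝᵈ` when `δ L(δ) → ∞`; this is what translation-invariant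
  continuum limits (OS2) require (a positive-orthant domain `{0,…,L−1}ᵈ` would force every
  limit in law to vanish on a half-space). Odd sides also make `[NeZero (2L+1)]` automatic.
  In `torusFieldLaw L μ δ ρ` the half-side `L` comes first (the type of `μ` depends on it); the
  S22/S23 call is `torusFieldLaw (L δ) (phi4TorusMeasure d (2 * L δ + 1) g κ J) δ 1`.
* Infinite-volume quantities (`phi4TwoPoint`, `phi4Susceptibility`, `phi4CriticalJ`) are
  junk-valued limits/infima exactly as in `StatMech.IsingThermodynamics`; documented below.
* Infinite-volume states are smeared over the finite boxes `box d (L δ)` with `δ L(δ) → ∞`;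
  `finLatticeField_tail_tendsto` records that for bounded fields the omitted tail is uniformly
  small. A full-lattice `latticeField` as a continuous linear functional (via
  `SchwartzMap.mkCLMtoNormedSpace`) is not provided in v0.
-/

open scoped SchwartzMap ENNReal
open MeasureTheory Filter Topology Finset

namespace Literature.MathematicalPhysics.QuantumLattice

open Literature.Probability.LatticeModels

/-! ## The lattice `φ⁴` action and measure on a finite graph -/

section Graph

variable {V : Type*} [Fintype V] (G : SimpleGraph V) [DecidableRel G.Adj]

/-- The nearest-neighbour (ferromagnetic, `J = 1`) pair interaction of a real lattice field on a
finite graph, `∑_{{x,y} ∈ E(G)} φₓ φ_y` (each unordered edge counted once).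
(Glimm–Jaffe 1987, §9.5; Aizenman–Duminil-Copin 2021, (1.1).) [cite: GlimmJaffe1987, §9.5] -/
def pairInteraction (φ : V → ℝ) : ℝ :=
  ∑ e ∈ G.edgeFinset, Sym2.lift ⟨fun x y => φ x * φ y, fun _ _ => mul_comm _ _⟩ e

/-- The lattice `φ⁴` action on a finite graph `G` with couplings `g` (quartic), `κ` (quadratic)
and `J` (nearest-neighbour):
`S(φ) = ∑ₓ (g φₓ⁴ + κ φₓ²) − J ∑_{{x,y} ∈ E(G)} φₓ φ_y`.

**Standard lattice regularisation dictionary** (Glimm–Jaffe 1987, §9.5–9.6), consumed verbatim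
by `constructive-qft.S22/S23`: the continuum action
`∫ (½|∇φ|² + ½(m² + δm²) φ² + λ φ⁴) dx` on the lattice `δℤᵈ` (forward differences for `∇`,
Riemann sums for `∫`) becomes `phi4Action (zdGraph d) g κ J` with
`g = λ δᵈ`, `κ = d δ^{d−2} + (m² + δm²(δ)) δᵈ / 2`, `J = δ^{d−2}`,
and the lattice field is smeared with field-strength factor `ρ = 1` (`finLatticeField … δ 1`).
The parameters are named `(g κ J)` rather than `λ` to avoid clashing with the continuum
coupling. (Griffiths–Simon 1973; Aizenman–Duminil-Copin 2021, §1.2.) [cite: GlimmJaffe1987, §9.5–9.6] -/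
def phi4Action (g κ J : ℝ) (φ : V → ℝ) : ℝ :=
  ∑ x, (g * φ x ^ 4 + κ * φ x ^ 2) - J * pairInteraction G φ

/-- The lattice `φ⁴` Gibbs measure on `V → ℝ`,
`dμ(φ) = Z⁻¹ exp (−S(φ)) ∏ₓ dφₓ` with `S = phi4Action G g κ J`, realised as the exponential tilt
of Lebesgue measure. It is a probability measure when `0 < g`
(`isProbabilityMeasure_phi4Measure`) and the zero measure when `exp (−S)` is not integrable.
(Glimm–Jaffe 1987, §9.5; Aizenman–Duminil-Copin 2021, (1.1).) [cite: GlimmJaffe1987, §9.5] -/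
noncomputable def phi4Measure (g κ J : ℝ) : Measure (V → ℝ) :=
  (volume : Measure (V → ℝ)).tilted fun φ => -phi4Action G g κ J φ

/-- The lattice field measure with single-site (a priori) law `ν` and nearest-neighbour coupling
`J`: `dμ(φ) = Z⁻¹ exp (J ∑_{xy} φₓ φ_y) ∏ₓ dν(φₓ)` (Ising: `ν = ½(δ₁ + δ₋₁)`; `φ⁴`:
`dν = e^{−gφ⁴−κφ²} dφ`). Zero measure if the tilt is not `ν^{⊗V}`-integrable.
(Griffiths–Simon 1973; Aizenman–Duminil-Copin 2021, §1.2.) [cite: GriffithsSimon1973] -/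
noncomputable def latticeFieldMeasure (ν : Measure ℝ) (J : ℝ) : Measure (V → ℝ) :=
  (Measure.pi fun _ : V => ν).tilted fun φ => J * pairInteraction G φ

omit [Fintype V] [DecidableRel G.Adj] in
/-- Analytic single-site hypotheses of the Griffiths–Simon / Aizenman–Duminil-Copin framework:
`ν` is an even probability measure on `ℝ` (Mathlib `Measure.IsNegInvariant`) with all
exponential moments finite. This records only the analytic properties consumed by H21
statements (well-definedness of `latticeFieldMeasure ν G J` for all `J`).

**WARNING.** The Griffiths–Simon class *proper* — weak limits of rescaled block spins of
ferromagnetic Ising models, which contains the `φ⁴` single-site laws `e^{−gφ⁴−κφ²} dφ` — is a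
*strict subclass* of this predicate, and the triviality / correlation-inequality theorems of
Aizenman–Duminil-Copin (Thm 1.2–1.3) genuinely need it (through the random-current
representation). Do **not** use `IsGriffithsSimonClass` as the hypothesis of ADC-type target
statements; those are stated for the concrete `φ⁴` and Ising laws.
(Griffiths–Simon, CMP 33 (1973); Aizenman–Duminil-Copin 2021, §1.2.) [cite: AizenmanDuminilCopin2021, §1.2] -/
structure IsGriffithsSimonClass (ν : Measure ℝ) : Prop where
  /-- `ν` is a probability measure. -/
  isProbabilityMeasure : IsProbabilityMeasure ν
  /-- `ν` is even: invariant under `φ ↦ −φ` (`ν.neg = ν`). -/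
  isNegInvariant : ν.IsNegInvariant
  /-- All exponential moments `∫ exp (a φ) dν(φ)` are finite. -/
  integrable_exp_mul : ∀ a : ℝ, Integrable (fun x : ℝ => Real.exp (a * x)) ν

/-- The pair interaction is measurable (a polynomial in the coordinates).
(Glimm–Jaffe 1987, §9.5.) [cite: GlimmJaffe1987, §9.5] -/
@[fun_prop]
theorem measurable_pairInteraction : Measurable (pairInteraction G) := by
  unfold pairInteraction
  refine Finset.measurable_sum _ fun e _ => ?_
  induction e using Sym2.ind with
  | h x y => simp only [Sym2.lift_mk]; fun_prop

/-- The `φ⁴` action is measurable. (Glimm–Jaffe 1987, §9.5.) [cite: GlimmJaffe1987, §9.5] -/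
@[fun_prop]
theorem measurable_phi4Action (g κ J : ℝ) : Measurable (phi4Action G g κ J) := by
  unfold phi4Action
  fun_prop

/-- For `0 < g` the lattice `φ⁴` measure is a probability measure: `exp (−S)` is Lebesgue
integrable since the quartic term dominates. Not an instance (it needs the hypothesis `0 < g`).
(Glimm–Jaffe 1987, §9.5; Aizenman–Duminil-Copin 2021, §1.2.) [cite: GlimmJaffe1987, §9.5] -/
def isProbabilityMeasure_phi4Measure : Prop :=
  ∀ {g : ℝ} (hg : 0 < g) (κ J : ℝ),
    IsProbabilityMeasure (phi4Measure G g κ J)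

end Graph

/-! ## `φ⁴` fields on `ℤᵈ`: finite volumes, torus, thermodynamic limit -/

section Zd

variable {d : ℕ}

/-- Extension by zero of a field on a finite volume `Λ ⊆ ℤᵈ` to all of `ℤᵈ`
(free boundary condition: `glueZero Λ φ x = φ x` for `x ∈ Λ`, `= 0` otherwise). This is an
abbreviation for the G02 gluing `StatMech.glueWith Λ φ 0` (itself Mathlib's
`Function.updateFinset 0 Λ φ`, `StatMech.glueWith_eq_updateFinset`); use the `glueWith` API
(`glueWith_apply_mem`, `glueWith_apply_not_mem`, `measurable_glueWith`).
(Friedli–Velenik 2017, §3.1; Glimm–Jaffe 1987, §9.5.) [cite: FriedliVelenik2017, §3.1] -/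
noncomputable abbrev glueZero (Λ : Finset (Site d)) (φ : Λ → ℝ) : Site d → ℝ :=
  glueWith Λ φ 0

/-- Extension by zero is measurable for the product σ-algebras (`StatMech.measurable_glueWith`,
i.e. Mathlib's `measurable_updateFinset`). (Georgii 2011, §1.2; Glimm–Jaffe 1987, §9.5.) [cite: Georgii2011, §1.2] -/
theorem measurable_glueZero (Λ : Finset (Site d)) : Measurable (glueZero Λ) :=
  measurable_glueWith Λ 0

variable (d)

/-- The nearest-neighbour graph of `ℤᵈ` induced on a finite volume `Λ` (free boundary
condition: only edges with both endpoints in `Λ`), as a graph on the subtype `↥Λ`; this is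
Mathlib's `SimpleGraph.comap Subtype.val` (= `SimpleGraph.induce`), an `abbrev` so that
`SimpleGraph.instDecidableComapAdj` provides decidability of adjacency.
(Friedli–Velenik 2017, §3.1, `ℰ_Λ`.) [cite: FriedliVelenik2017, §3.1   ℰ_Λ] -/
noncomputable abbrev zdGraphIn (Λ : Finset (Site d)) : SimpleGraph Λ :=
  (zdGraph d).comap Subtype.val

/-- Adjacency in the induced graph is adjacency in `ℤᵈ`. (Friedli–Velenik 2017, §3.1.) [cite: FriedliVelenik2017, §3.1] -/
theorem zdGraphIn_adj {Λ : Finset (Site d)} (x y : Λ) :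
    (zdGraphIn d Λ).Adj x y ↔ (zdGraph d).Adj x y := Iff.rfl

/-- The finite-volume lattice `φ⁴` measure on `ℤᵈ` with free boundary condition in `Λ`,
pushed forward to `Site d → ℝ` by extension by zero:
`phi4Measure (zdGraphIn d Λ) g κ J` glued with `0` outside `Λ`.
(Glimm–Jaffe 1987, §9.5; Aizenman–Duminil-Copin 2021, §1.2.) [cite: GlimmJaffe1987, §9.5] -/
noncomputable def phi4FreeMeasure (Λ : Finset (Site d)) (g κ J : ℝ) : Measure (Site d → ℝ) :=
  (phi4Measure (zdGraphIn d Λ) g κ J).map (glueZero Λ)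

/-- The `φ⁴` measure in the box `box d L = {−L,…,L}ᵈ` with free boundary condition, on
`Site d → ℝ`. (Glimm–Jaffe 1987, §9.5; Friedli–Velenik 2017, §3.2.) [cite: GlimmJaffe1987, §9.5] -/
noncomputable def phi4BoxMeasure (L : ℕ) (g κ J : ℝ) : Measure (Site d → ℝ) :=
  phi4FreeMeasure d (box d L) g κ J

/-- The `φ⁴` measure on the discrete torus `(ℤ/Lℤ)ᵈ` (periodic boundary condition), kept on
`TorusSite d L → ℝ`. Requires `[NeZero L]` (`Fintype (ZMod L)`). For the continuum limits of
`constructive-qft.S22/S23` it is used with **odd side** `2L+1` and smeared through the *centred*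
fundamental domain `box d L = {−L,…,L}ᵈ` (`finLatticeFieldTorus`, `torusFieldLaw`), so that
`[NeZero (2L+1)]` is automatic. For `L ≤ 2` the graph `torusGraph d L` is simple (no doubled
bonds), as inherited from `StatMech.torusGraph`; irrelevant as `L → ∞`.
(Glimm–Jaffe 1987, §9.5–9.6.) [cite: GlimmJaffe1987, §9.5–9.6] -/
noncomputable def phi4TorusMeasure (L : ℕ) [NeZero L] (g κ J : ℝ) : Measure (TorusSite d L → ℝ) :=
  phi4Measure (torusGraph d L) g κ J

/-- The finite-volume (free b.c.) two-point function `⟨φₓ φ_y⟩_{Λ; g,κ,J}`, an instance of the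
generic `StatMech.twoPoint` for the coordinate field `x ↦ (φ ↦ φ x)` (junk `0` if not
integrable, e.g. when the measure is zero). (Glimm–Jaffe 1987, §4.2, §9.5.) [cite: GlimmJaffe1987, §4.2  §9.5] -/
noncomputable def phi4TwoPointIn (Λ : Finset (Site d)) (g κ J : ℝ) (x y : Site d) : ℝ :=
  Literature.Probability.LatticeModels.twoPoint (phi4FreeMeasure d Λ g κ J) (fun z (φ : Site d → ℝ) => φ z) x y

/-- The two-point function in the box `box d L` with free boundary condition.
(Glimm–Jaffe 1987, §9.5; Friedli–Velenik 2017, §3.7.4.) [cite: GlimmJaffe1987, §9.5] -/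
noncomputable def phi4TwoPointBox (L : ℕ) (g κ J : ℝ) (x y : Site d) : ℝ :=
  phi4TwoPointIn d (box d L) g κ J x y

/-- The infinite-volume (free b.c.) two-point function `⟨φ₀ φₓ⟩_{g,κ,J} = lim_L ⟨φ₀ φₓ⟩_{B(L)}`
via `StatMech.boxLim`. **Junk-valued** if the box limit does not exist (it exists for
`0 ≤ J` by the Griffiths inequalities). (Friedli–Velenik 2017, §3.7.4; Aizenman–Duminil-Copin
2021, §1.2.) [cite: FriedliVelenik2017, §3.7.4] -/
noncomputable def phi4TwoPoint (g κ J : ℝ) (x : Site d) : ℝ :=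
  boxLim fun Λ : Finset (Site d) => phi4TwoPointIn d Λ g κ J 0 x

/-- The susceptibility `χ(g,κ,J) = ∑_{x ∈ ℤᵈ} ⟨φ₀ φₓ⟩ ∈ [0, ∞]` as an extended nonnegative
real (summands are nonnegative for `0 ≤ J` by Griffiths' first inequality; `χ = ∞` is a
genuine value at and above criticality). (Friedli–Velenik 2017, §3.7.4; Aizenman–Duminil-Copin
2021, §1.2.) [cite: FriedliVelenik2017, §3.7.4] -/
noncomputable def phi4Susceptibility (g κ J : ℝ) : ℝ≥0∞ :=
  ∑' x : Site d, ENNReal.ofReal (phi4TwoPoint d g κ J x)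

/-- The critical nearest-neighbour coupling `J_c(g,κ) = inf {J ≥ 0 | χ(g,κ,J) = ∞}` at fixed
single-site potential. **Junk value**: `sInf ∅ = 0` in `ℝ` if the susceptibility is finite for
all `J ≥ 0` (e.g. `d ≤ 1` situations or degenerate parameters); statements about
`phi4CriticalJ` assume the set is nonempty. (Aizenman–Duminil-Copin 2021, §1.2;
Friedli–Velenik 2017, §3.7.) [cite: AizenmanDuminilCopin2021, §1.2] -/
noncomputable def phi4CriticalJ (g κ : ℝ) : ℝ :=
  sInf {J : ℝ | 0 ≤ J ∧ phi4Susceptibility d g κ J = ⊤}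

/-- `J_c(g,κ) ≥ 0` (all members of the defining set are `≥ 0`, and `sInf ∅ = 0`).
(Aizenman–Duminil-Copin 2021, §1.2; Friedli–Velenik 2017, §3.7.) [cite: AizenmanDuminilCopin2021, §1.2] -/
theorem phi4CriticalJ_nonneg (g κ : ℝ) : 0 ≤ phi4CriticalJ d g κ :=
  Real.sInf_nonneg fun _ hJ => hJ.1

/-- A family of nearest-neighbour couplings `J(δ)`, indexed by the lattice spacing `δ > 0`, is
*critical or near-critical* (at fixed `g κ`): `0 ≤ J(δ) ≤ J_c` for all `δ > 0` and
`J(δ) → J_c` as `δ → 0⁺`. This is the regime of Aizenman–Duminil-Copin 2021, Thm 1.2–1.3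
(scaling limits taken from the high-temperature side, approaching the critical point).
(Aizenman–Duminil-Copin, Ann. Math. 194 (2021), §1.2.) [cite: AizenmanDuminilCopin2021, Thm 1.2–1.3 (scaling limits taken from t] -/
def IsCriticalFamily (g κ : ℝ) (J : ℝ → ℝ) : Prop :=
  (∀ δ : ℝ, 0 < δ → 0 ≤ J δ ∧ J δ ≤ phi4CriticalJ d g κ) ∧
    Tendsto J (𝓝[>] 0) (𝓝 (phi4CriticalJ d g κ))

end Zd

/-! ## Smearing lattice fields against Schwartz test functions -/

section Smearing

variable {d : ℕ}

/-- The embedding of a lattice site `x ∈ ℤᵈ` into Euclidean space `ℝᵈ`, coordinatewise.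
(Glimm–Jaffe 1987, §9.5; Aizenman–Duminil-Copin 2021, §1.2.) [cite: GlimmJaffe1987, §9.5] -/
noncomputable def siteToE (x : Site d) : EuclideanSpace ℝ (Fin d) :=
  WithLp.toLp 2 fun i => (x i : ℝ)

/-- Coordinates of `siteToE`. (Aizenman–Duminil-Copin 2021, §1.2.) [cite: AizenmanDuminilCopin2021, §1.2] -/
@[simp]
theorem siteToE_apply (x : Site d) (i : Fin d) : siteToE x i = (x i : ℝ) := rfl

/-- The *smeared lattice field* of a configuration `φ : ℤᵈ → ℝ` restricted to the finite volume
`Λ`, at lattice spacing `δ` and with field-strength factor `ρ`, as a tempered distribution on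
`ℝᵈ`: `finLatticeField Λ δ ρ φ = ∑_{x ∈ Λ} (ρ δᵈ φₓ) • δ_{δx}`, i.e.
`Φ_δ(f) = ρ δᵈ ∑_{x ∈ Λ} f(δx) φₓ` (`finLatticeField_apply`).
(Aizenman–Duminil-Copin 2021, (1.5) `T_{f,L}`; Glimm–Jaffe 1987, §9.5.) [cite: AizenmanDuminilCopin2021, (1.5] -/
noncomputable def finLatticeField (Λ : Finset (Site d)) (δ ρ : ℝ) (φ : Site d → ℝ) :
    FieldConfig (EuclideanSpace ℝ (Fin d)) :=
  ∑ x ∈ Λ, (ρ * δ ^ d * φ x) • deltaConfig (δ • siteToE x)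

/-- `Φ_δ(f) = ∑_{x ∈ Λ} ρ δᵈ φₓ f(δx)`. (Aizenman–Duminil-Copin 2021, (1.5).) [cite: AizenmanDuminilCopin2021, (1.5] -/
@[simp]
theorem finLatticeField_apply (Λ : Finset (Site d)) (δ ρ : ℝ) (φ : Site d → ℝ)
    (f : 𝓢(EuclideanSpace ℝ (Fin d), ℝ)) :
    finLatticeField Λ δ ρ φ f = ∑ x ∈ Λ, ρ * δ ^ d * φ x * f (δ • siteToE x) := by
  simp [finLatticeField, smul_eq_mul]

/-- The smearing map `φ ↦ Φ_δ` is measurable from the product σ-algebra on `ℤᵈ → ℝ` to the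
Borel σ-algebra of `FieldConfig ℝᵈ`. (Glimm–Jaffe 1987, §6.1, §9.5.) [cite: GlimmJaffe1987, §6.1  §9.5] -/
@[fun_prop]
theorem measurable_finLatticeField (Λ : Finset (Site d)) (δ ρ : ℝ) :
    Measurable (finLatticeField (d := d) Λ δ ρ) :=
  measurable_finset_sum_smul_deltaConfig Λ (fun x (φ : Site d → ℝ) => ρ * δ ^ d * φ x)
    (fun x => (measurable_pi_apply x).const_mul _) _

/-- The smeared field of a periodic configuration `φ : (ℤ/(2L+1)ℤ)ᵈ → ℝ` on a torus of **odd
side** `2L+1`: lift `φ` to `ℤᵈ` along `Torus.proj (2L+1)` and smear over the **centred**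
fundamental domain `box d L = {−L,…,L}ᵈ` (a cube of side `(2L+1) δ` centred at the origin of
`ℝᵈ`), `Φ_δ(f) = ρ δᵈ ∑_{x ∈ box d L} f(δx) φ_{proj x}`. Centring is essential: with
`δ → 0`, `δ L → ∞` the cubes exhaust `ℝᵈ`, as needed for translation-invariant continuum limits
(a positive-orthant domain `{0,…,L−1}ᵈ` would kill every limit on a half-space).
(Glimm–Jaffe 1987, §9.5–9.6.) [cite: GlimmJaffe1987, §9.5–9.6] -/
noncomputable def finLatticeFieldTorus (L : ℕ) (δ ρ : ℝ) (φ : TorusSite d (2 * L + 1) → ℝ) :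
    FieldConfig (EuclideanSpace ℝ (Fin d)) :=
  finLatticeField (box d L) δ ρ (φ ∘ Torus.proj (2 * L + 1))

/-- Unfolding lemma: the centred torus smearing is `finLatticeField (box d L)` of the periodic
lift. (Glimm–Jaffe 1987, §9.5.) [cite: GlimmJaffe1987, §9.5] -/
theorem finLatticeFieldTorus_eq (L : ℕ) (δ ρ : ℝ) (φ : TorusSite d (2 * L + 1) → ℝ) :
    finLatticeFieldTorus L δ ρ φ = finLatticeField (box d L) δ ρ (φ ∘ Torus.proj (2 * L + 1)) :=
  rfl

/-- The torus smearing map is measurable. (Glimm–Jaffe 1987, §6.1, §9.5.) [cite: GlimmJaffe1987, §6.1  §9.5] -/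
@[fun_prop]
theorem measurable_finLatticeFieldTorus (L : ℕ) (δ ρ : ℝ) :
    Measurable (finLatticeFieldTorus (d := d) L δ ρ) := by
  refine (measurable_finLatticeField _ δ ρ).comp ?_
  exact measurable_pi_lambda _ fun x => measurable_pi_apply (Torus.proj (2 * L + 1) x)

/-- The law of the smeared field: push-forward of a measure `μ` on lattice configurations
`ℤᵈ → ℝ` along `finLatticeField Λ δ ρ`, a measure on `FieldConfig ℝᵈ`. Infinite-volume states
`μ` are smeared over `Λ = box d (L δ)` with `δ L(δ) → ∞` (see `finLatticeField_tail_tendsto`).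
(Aizenman–Duminil-Copin 2021, §1.2; Glimm–Jaffe 1987, §9.6.) [cite: AizenmanDuminilCopin2021, §1.2] -/
noncomputable def latticeFieldLaw (μ : Measure (Site d → ℝ)) (Λ : Finset (Site d)) (δ ρ : ℝ) :
    Measure (FieldConfig (EuclideanSpace ℝ (Fin d))) :=
  μ.map (finLatticeField Λ δ ρ)

/-- The law of the smeared periodic field: push-forward of a measure `μ` on `(ℤ/(2L+1)ℤ)ᵈ → ℝ`
along the centred torus smearing `finLatticeFieldTorus L δ ρ` (fundamental domain `box d L`).
The half-side `L` comes first since the type of `μ` depends on it; the standard call for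
`constructive-qft.S22/S23` is
`torusFieldLaw (L δ) (phi4TorusMeasure d (2 * L δ + 1) g κ J) δ 1` with `δ L(δ) → ∞`.
(Glimm–Jaffe 1987, §9.6.) [cite: GlimmJaffe1987, §9.6] -/
noncomputable def torusFieldLaw (L : ℕ) (μ : Measure (TorusSite d (2 * L + 1) → ℝ)) (δ ρ : ℝ) :
    Measure (FieldConfig (EuclideanSpace ℝ (Fin d))) :=
  μ.map (finLatticeFieldTorus L δ ρ)

/-- The smeared Ising spin field `∑_{x ∈ Λ} (ρ δᵈ σₓ) • δ_{δx}` of a spin configuration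
`σ : ℤᵈ → {±1}`. (Aizenman–Duminil-Copin 2021, (1.5); Camia–Garban–Newman 2015.) [cite: AizenmanDuminilCopin2021, (1.5] -/
noncomputable def spinField (Λ : Finset (Site d)) (δ ρ : ℝ) (σ : SpinConfig (Site d)) :
    FieldConfig (EuclideanSpace ℝ (Fin d)) :=
  finLatticeField Λ δ ρ fun x => spinAt x σ

/-- The spin smearing map is measurable. (Aizenman–Duminil-Copin 2021, §1.2.) [cite: AizenmanDuminilCopin2021, §1.2] -/
@[fun_prop]
theorem measurable_spinField (Λ : Finset (Site d)) (δ ρ : ℝ) :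
    Measurable (spinField (d := d) Λ δ ρ) :=
  (measurable_finLatticeField Λ δ ρ).comp (measurable_pi_lambda _ fun x => measurable_spinAt x)

/-- The law of the smeared spin field under a measure `μ` on spin configurations of `ℤᵈ`.
(Aizenman–Duminil-Copin 2021, §1.2.) [cite: AizenmanDuminilCopin2021, §1.2] -/
noncomputable def spinFieldLaw (μ : Measure (SpinConfig (Site d))) (Λ : Finset (Site d))
    (δ ρ : ℝ) : Measure (FieldConfig (EuclideanSpace ℝ (Fin d))) :=
  μ.map (spinField Λ δ ρ)

/-- Push-forward laws of probability measures are probability measures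
(`Measure.isProbabilityMeasure_map`; Glimm–Jaffe 1987, §9.6). [cite: GlimmJaffe1987, §9.6] -/
instance (μ : Measure (Site d → ℝ)) [IsProbabilityMeasure μ] (Λ : Finset (Site d)) (δ ρ : ℝ) :
    IsProbabilityMeasure (latticeFieldLaw μ Λ δ ρ) :=
  Measure.isProbabilityMeasure_map (measurable_finLatticeField Λ δ ρ).aemeasurable

/-- Push-forward laws of probability measures are probability measures
(`Measure.isProbabilityMeasure_map`; Glimm–Jaffe 1987, §9.6). [cite: GlimmJaffe1987, §9.6] -/
instance (L : ℕ) (μ : Measure (TorusSite d (2 * L + 1) → ℝ)) [IsProbabilityMeasure μ]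
    (δ ρ : ℝ) : IsProbabilityMeasure (torusFieldLaw L μ δ ρ) :=
  Measure.isProbabilityMeasure_map (measurable_finLatticeFieldTorus L δ ρ).aemeasurable

/-- Push-forward laws of probability measures are probability measures
(`Measure.isProbabilityMeasure_map`; Glimm–Jaffe 1987, §9.6). [cite: GlimmJaffe1987, §9.6] -/
instance (μ : Measure (SpinConfig (Site d))) [IsProbabilityMeasure μ] (Λ : Finset (Site d))
    (δ ρ : ℝ) : IsProbabilityMeasure (spinFieldLaw μ Λ δ ρ) :=
  Measure.isProbabilityMeasure_map (measurable_spinField Λ δ ρ).aemeasurable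

/-- **Tail lemma** for smearing infinite-volume configurations over growing boxes: for a
Schwartz test function `f`, a fixed field-strength factor `ρ` and a bound `C`, if
`δ L(δ) → ∞` as `δ → 0⁺` then, uniformly over configurations with `|φₓ| ≤ C`, the smeared field
over `box d (L δ)` differs from the full lattice sum `ρ δᵈ ∑_{x ∈ ℤᵈ} φₓ f(δx)` by at most `ε`
eventually. (Riemann-sum tail estimate; Glimm–Jaffe 1987, §9.5–9.6; Aizenman–Duminil-Copin 2021,
§1.2.) [cite: GlimmJaffe1987, §9.5–9.6] -/
def finLatticeField_tail_tendsto : Prop :=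
  ∀ (f : 𝓢(EuclideanSpace ℝ (Fin d), ℝ)) (ρ C : ℝ) (L : ℝ → ℕ) (hL : Tendsto (fun δ => δ * L δ) (𝓝[>] 0) atTop) (ε : ℝ) (hε : 0 < ε),
    ∀ᶠ δ in 𝓝[>] 0, ∀ φ : Site d → ℝ, (∀ x, |φ x| ≤ C) →
      |ρ * δ ^ d * (∑' x : Site d, φ x * f (δ • siteToE x)) -
        finLatticeField (box d (L δ)) δ ρ φ f| ≤ ε

end Smearing

end Literature.MathematicalPhysics.QuantumLattice
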